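import Summits.QuantumFields.YangMills.Theorems.SoloBlindLatticeGapAntipodal
import HarnessLib

/-!
# Translates, linear combinations, smearings of species (solo-QuantumFields-blind, rung D20a)

## The statement's correlator is bilinear and translation invariant

`Summit.QuantumFields.YangMills` couples the continuum datum `T` to the lattice through smeared
fields `Φ_i(f)(U) = a⁴ ∑ₓ f(a x) · c_i · s_i(τₓ U)` (`smearedLatticeField`): finite linear
combinations of TRANSLATES of one species.  This file supplies the (folklore) algebra the gap
analysis of such witnesses needs (rung D20, `SoloBlindSmearedGapConstant`):

* `translateSpecies O z` (`O(· + z)`, i.e. `O.F ∘ θ_{-z}`), `linCombSpecies s h A` (`∑ᵢ hᵢ Aᵢ`)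
  and
  `smearSpecies O s h z = ∑ᵢ hᵢ O(· + zᵢ)` are again gauge-invariant local observables
  (`YMSpecies`: cylinder, gauge invariant — translations intertwine gauge transformations,
  `configShift_gaugeTransformZd` — bounded, measurable), and time-zero spatial when `O` is and the
  `zᵢ` are spatial (`zᵢ 0 = 0`);
* `latticeConnectedCorr_sum_sum` / `latticeConnectedCorr_linCombSpecies`: the statement's
  correlator `latticeConnectedCorr ρ β S A B n` is BILINEAR in bounded measurable `A`, `B`;
* `latticeConnectedCorr_comp_configShift`: it is TRANSLATION INVARIANT,
  `c_{A∘θ_w, B∘θ_w}(S; n) = c_{A,B}(S; n)` for every `w ∈ ℤ⁴` (the torus Wilson state is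
  invariant,
  `wilsonExpectation_comp_torusConfigShift`, and translations commute); hence
  `c_{O(·+z), O'(·+z')} = c_{O, O'(·+(z'-z))}` and `c_{O(·+z),O(·+z)} = c_{O,O}`.

References: E. Seiler, LNP 159 (1982) Ch. 2 (local gauge-invariant observables, translation
invariance); H.-O. Georgii, *Gibbs Measures and Phase Transitions* (2011) (5.3)–(5.4).
[folklore; the typed statements over the summit's `YMSpecies` are this unit's]
-/

open MeasureTheory Filter Topology
open Literature.MathematicalPhysics.QuantumFieldTheory Literature.MathematicalPhysics.QuantumLattice

noncomputable section

namespace Summit.QuantumFields.YangMills.Theorems.SoloBlind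

variable {G : Type} [Group G] [TopologicalSpace G] [IsTopologicalGroup G] [CompactSpace G]
  [MeasurableSpace G] [BorelSpace G]

/-! ### Translates and finite linear combinations of species -/

omit [TopologicalSpace G] [IsTopologicalGroup G] [CompactSpace G] [BorelSpace G] in
/-- Translation intertwines gauge transformations: `θ_v(U^g) = (θ_v U)^{g(· - v)}`. [folklore] -/
theorem configShift_gaugeTransformZd (v : Literature.Probability.LatticeModels.Site 4)
    (g : Literature.Probability.LatticeModels.Site 4 → G) (U : LGConfig 4 G) :
    configShift v (gaugeTransformZd g U) =
      gaugeTransformZd (fun x => g (x - v)) (configShift v U) := by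
  funext e
  simp only [configShift_apply, gaugeTransformZd, add_sub_right_comm]

/-- **The translate `A(· + z)` of a species**: `F := A.F ∘ θ_{-z}`
(`θ_{-z} U (x, i) = U (x + z, i)`),
the observable `A` placed at `z`; again a gauge-invariant local observable. [folklore] -/
def translateSpecies (A : YMSpecies G) (z : Literature.Probability.LatticeModels.Site 4) :
    YMSpecies G where
  F := A.F ∘ configShift (-z)
  supp := A.supp.image fun e => (e.1 - -z, e.2)
  isCylinder := IsCylinder.comp_configShift A.isCylinder (-z)
  gaugeInvariant g U := by
    change A.F (configShift (-z) (gaugeTransformZd g U)) = A.F (configShift (-z) U)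
    rw [configShift_gaugeTransformZd, A.gaugeInvariant]
  bounded := A.bounded.imp fun _ hC U => hC _
  measurable := A.measurable.comp (configShift (-z)).measurable

omit [TopologicalSpace G] [IsTopologicalGroup G] [CompactSpace G] [BorelSpace G] in
/-- The underlying function of the translate. -/
@[simp] theorem translateSpecies_F (A : YMSpecies G)
    (z : Literature.Probability.LatticeModels.Site 4) :
    (translateSpecies A z).F = A.F ∘ configShift (-z) := rfl

omit [TopologicalSpace G] [IsTopologicalGroup G] [CompactSpace G] [BorelSpace G] in
/-- A spatial translate of a time-zero spatial species is time-zero spatial. -/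
theorem isTimeZeroSpatial_translateSpecies {A : YMSpecies G} (hA : IsTimeZeroSpatial A)
    {z : Literature.Probability.LatticeModels.Site 4} (hz : z 0 = 0) :
    IsTimeZeroSpatial (translateSpecies A z) := by
  intro e he
  change e ∈ A.supp.image (fun e => (e.1 - -z, e.2)) at he
  obtain ⟨e', he', rfl⟩ := Finset.mem_image.1 he
  obtain ⟨h0, h2⟩ := hA e' he'
  refine ⟨?_, h2⟩
  simp [h0, hz]

/-- **Finite linear combination of species** `∑ᵢ hᵢ Aᵢ`; again a gauge-invariant local observable
(support the union of the supports). [folklore] -/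
def linCombSpecies {ι : Type*} (s : Finset ι) (h : ι → ℝ) (A : ι → YMSpecies G) : YMSpecies G where
  F U := ∑ i ∈ s, h i * (A i).F U
  supp := s.biUnion fun i => (A i).supp
  isCylinder U V hUV := by
    refine Finset.sum_congr rfl fun i hi => ?_
    congr 1
    exact (A i).isCylinder fun e he =>
      hUV e (Finset.mem_coe.2 (Finset.mem_biUnion.2 ⟨i, hi, Finset.mem_coe.1 he⟩))
  gaugeInvariant g U := by
    change ∑ i ∈ s, h i * (A i).F (gaugeTransformZd g U) = ∑ i ∈ s, h i * (A i).F U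
    exact Finset.sum_congr rfl fun i _ => by rw [(A i).gaugeInvariant]
  bounded := by
    classical
    refine ⟨∑ i ∈ s, |h i| * Classical.choose (A i).bounded, fun U => ?_⟩
    refine (Finset.abs_sum_le_sum_abs _ _).trans (Finset.sum_le_sum fun i _ => ?_)
    rw [abs_mul]
    exact mul_le_mul_of_nonneg_left (Classical.choose_spec (A i).bounded U) (abs_nonneg _)
  measurable := Finset.measurable_sum _ fun i _ => (A i).measurable.const_mul _

omit [TopologicalSpace G] [IsTopologicalGroup G] [CompactSpace G] [BorelSpace G] in
/-- The underlying function of the linear combination. -/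
@[simp] theorem linCombSpecies_F {ι : Type*} (s : Finset ι) (h : ι → ℝ) (A : ι → YMSpecies G) :
    (linCombSpecies s h A).F = fun U => ∑ i ∈ s, h i * (A i).F U := rfl

omit [TopologicalSpace G] [IsTopologicalGroup G] [CompactSpace G] [BorelSpace G] in
/-- A linear combination of time-zero spatial species is time-zero spatial. -/
theorem isTimeZeroSpatial_linCombSpecies {ι : Type*} {s : Finset ι} {h : ι → ℝ}
    {A : ι → YMSpecies G}
    (hA : ∀ i ∈ s, IsTimeZeroSpatial (A i)) : IsTimeZeroSpatial (linCombSpecies s h A) := by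
  intro e he
  change e ∈ s.biUnion (fun i => (A i).supp) at he
  obtain ⟨i, hi, he'⟩ := Finset.mem_biUnion.1 he
  exact hA i hi e he'

/-! ### Bilinearity of the statement's correlator -/

/-- A bounded measurable real function on the torus is integrable for Wilson's (finite) measure. -/
private theorem integrable_wilson_of_abs_le {N : ℕ} (ρ : G →* Matrix (Fin N) (Fin N) ℂ)
    (hρ : Continuous ρ) (β : ℝ) {S : ℕ} [NeZero S] {X : GaugeConfig 4 S G → ℝ} (hX : Measurable X)
    {C : ℝ} (hC : ∀ U, |X U| ≤ C) : Integrable X (wilsonMeasure (d := 4) (L := S) ρ β) := by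
  haveI := isProbabilityMeasure_wilsonMeasure (d := 4) (L := S) (G := G) ρ hρ β
  exact Integrable.of_bound hX.aestronglyMeasurable C
    (ae_of_all _ fun U => by rw [Real.norm_eq_abs]; exact hC U)

/-- **Bilinearity**: the statement's correlator of two finite linear combinations of bounded
measurable observables is the double sum of the pair correlators. [folklore] -/
theorem latticeConnectedCorr_sum_sum {N : ℕ} (ρ : G →* Matrix (Fin N) (Fin N) ℂ) (hρ : Continuous ρ)
    (β : ℝ) (S : ℕ) [NeZero S] {ι κ : Type*} (s : Finset ι) (t : Finset κ) (a : ι → ℝ) (b : κ → ℝ)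
    (A : ι → LGConfig 4 G → ℝ) (B : κ → LGConfig 4 G → ℝ) (hAm : ∀ i, Measurable (A i))
    (hAb : ∀ i, ∃ C : ℝ, ∀ U, |A i U| ≤ C) (hBm : ∀ j, Measurable (B j))
    (hBb : ∀ j, ∃ C : ℝ, ∀ U, |B j U| ≤ C) (n : ℕ) :
    latticeConnectedCorr ρ β S (fun U => ∑ i ∈ s, a i * A i U) (fun U => ∑ j ∈ t, b j * B j U) n =
      ∑ i ∈ s, ∑ j ∈ t, a i * b j * latticeConnectedCorr ρ β S (A i) (B j) n := by
  set μ := wilsonMeasure (d := 4) (L := S) ρ β with hμ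
  -- the lifted observables and their integrability
  set A' : ι → GaugeConfig 4 S G → ℝ := fun i U => A i (torusLift S U) with hA'
  set B' : κ → GaugeConfig 4 S G → ℝ := fun j U => B j (torusLift S U) with hB'
  set Bn : κ → GaugeConfig 4 S G → ℝ :=
    fun j U => B j (configShift (-Pi.single 0 (n : ℤ)) (torusLift S U)) with hBn
  have hA'm : ∀ i, Measurable (A' i) := fun i => (hAm i).comp (measurable_torusLift S)
  have hB'm : ∀ j, Measurable (B' j) := fun j => (hBm j).comp (measurable_torusLift S)
  have hBnm : ∀ j, Measurable (Bn j) := fun j =>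
    (hBm j).comp ((configShift _).measurable.comp (measurable_torusLift S))
  have hA'i : ∀ i, Integrable (A' i) μ := fun i => by
    obtain ⟨C, hC⟩ := hAb i
    exact integrable_wilson_of_abs_le ρ hρ β (hA'm i) fun U => hC _
  have hB'i : ∀ j, Integrable (B' j) μ := fun j => by
    obtain ⟨C, hC⟩ := hBb j
    exact integrable_wilson_of_abs_le ρ hρ β (hB'm j) fun U => hC _
  have hABi : ∀ i j, Integrable (fun U => A' i U * Bn j U) μ := fun i j => by
    obtain ⟨C, hC⟩ := hAb i
    obtain ⟨D, hD⟩ := hBb j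
    have hC0 : 0 ≤ C := (abs_nonneg _).trans (hC (fun _ => 1))
    exact integrable_wilson_of_abs_le ρ hρ β ((hA'm i).mul (hBnm j)) fun U => by
      rw [abs_mul]; exact mul_le_mul (hC _) (hD _) (abs_nonneg _) hC0
  -- expand the three integrals
  have h1 : ∫ U, (∑ i ∈ s, a i * A i (torusLift S U)) *
        (∑ j ∈ t, b j * B j (configShift (-Pi.single 0 (n : ℤ)) (torusLift S U))) ∂μ =
      ∑ i ∈ s, ∑ j ∈ t, a i * b j * ∫ U, A' i U * Bn j U ∂μ := by
    have hre : (fun U => (∑ i ∈ s, a i * A i (torusLift S U)) *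
        (∑ j ∈ t, b j * B j (configShift (-Pi.single 0 (n : ℤ)) (torusLift S U)))) =
        fun U => ∑ i ∈ s, ∑ j ∈ t, a i * b j * (A' i U * Bn j U) := by
      funext U
      rw [Finset.sum_mul_sum]
      refine Finset.sum_congr rfl fun i _ => Finset.sum_congr rfl fun j _ => ?_
      simp only [hA', hBn]; ring
    rw [hre, integral_finsetSum _ fun i _ => ?_]
    · refine Finset.sum_congr rfl fun i _ => ?_
      rw [integral_finsetSum _ fun j _ => ((hABi i j).const_mul _)]
      exact Finset.sum_congr rfl fun j _ => integral_const_mul _ _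
    · exact integrable_finsetSum _ fun j _ => (hABi i j).const_mul _
  have h2 : ∫ U, (∑ i ∈ s, a i * A i (torusLift S U)) ∂μ = ∑ i ∈ s, a i * ∫ U, A' i U ∂μ := by
    rw [integral_finsetSum _ fun i _ => ((hA'i i).const_mul _)]
    exact Finset.sum_congr rfl fun i _ => integral_const_mul _ _
  have h3 : ∫ U, (∑ j ∈ t, b j * B j (torusLift S U)) ∂μ = ∑ j ∈ t, b j * ∫ U, B' j U ∂μ := by
    rw [integral_finsetSum _ fun j _ => ((hB'i j).const_mul _)]
    exact Finset.sum_congr rfl fun j _ => integral_const_mul _ _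
  unfold latticeConnectedCorr
  rw [h1, h2, h3, Finset.sum_mul_sum, ← Finset.sum_sub_distrib]
  refine Finset.sum_congr rfl fun i _ => ?_
  rw [← Finset.sum_sub_distrib]
  refine Finset.sum_congr rfl fun j _ => ?_
  simp only [hA', hB', hBn]
  ring

/-- Bilinearity for linear combinations of species. -/
theorem latticeConnectedCorr_linCombSpecies {N : ℕ} (ρ : G →* Matrix (Fin N) (Fin N) ℂ)
    (hρ : Continuous ρ) (β : ℝ) (S : ℕ) [NeZero S] {ι κ : Type*} (s : Finset ι) (t : Finset κ)
    (a : ι → ℝ) (b : κ → ℝ) (A : ι → YMSpecies G) (B : κ → YMSpecies G) (n : ℕ) :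
    latticeConnectedCorr ρ β S (linCombSpecies s a A).F (linCombSpecies t b B).F n =
      ∑ i ∈ s, ∑ j ∈ t, a i * b j * latticeConnectedCorr ρ β S (A i).F (B j).F n :=
  latticeConnectedCorr_sum_sum ρ hρ β S s t a b (fun i => (A i).F) (fun j => (B j).F)
    (fun i => (A i).measurable) (fun i => (A i).bounded) (fun j => (B j).measurable)
    (fun j => (B j).bounded) n

/-! ### Translation invariance of the statement's correlator -/

/-- **Translation invariance**: `c_{A∘θ_w, B∘θ_w}(S; n) = c_{A,B}(S; n)` for every `w ∈ ℤ⁴`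
(the torus Wilson state is translation invariant; translations commute). [folklore] -/
theorem latticeConnectedCorr_comp_configShift {N : ℕ} (ρ : G →* Matrix (Fin N) (Fin N) ℂ)
    (β : ℝ) (S : ℕ) [NeZero S] (A B : LGConfig 4 G → ℝ)
    (w : Literature.Probability.LatticeModels.Site 4) (n : ℕ) :
    latticeConnectedCorr ρ β S (A ∘ configShift w) (B ∘ configShift w) n =
      latticeConnectedCorr ρ β S A B n := by
  have hcomm : ∀ U : LGConfig 4 G, configShift w (configShift (-Pi.single 0 (n : ℤ)) U) =
      configShift (-Pi.single 0 (n : ℤ)) (configShift w U) := by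
    intro U; funext e
    simp only [configShift_apply, sub_sub, add_comm]
  have hprod : (fun U => (A ∘ configShift w) U * (B ∘ configShift w)
        (configShift (-Pi.single 0 (n : ℤ)) U)) =
      (fun U => A U * B (configShift (-Pi.single 0 (n : ℤ)) U)) ∘ configShift w := by
    funext U
    simp only [Function.comp_apply, hcomm]
  rw [latticeConnectedCorr_eq_wilsonExpectation, latticeConnectedCorr_eq_wilsonExpectation, hprod,
    toTorusObservable_comp_configShift, toTorusObservable_comp_configShift,
    toTorusObservable_comp_configShift, wilsonExpectation_comp_torusConfigShift,
    wilsonExpectation_comp_torusConfigShift, wilsonExpectation_comp_torusConfigShift]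

/-- The correlator of two translates `A(· + z)`, `B(· + z')` is that of `A` and
`B(· + (z' - z))`. -/
theorem latticeConnectedCorr_translateSpecies_translateSpecies {N : ℕ}
    (ρ : G →* Matrix (Fin N) (Fin N) ℂ) (β : ℝ) (S : ℕ) [NeZero S] (A B : YMSpecies G)
    (z z' : Literature.Probability.LatticeModels.Site 4) (n : ℕ) :
    latticeConnectedCorr ρ β S (translateSpecies A z).F (translateSpecies B z').F n =
      latticeConnectedCorr ρ β S A.F (translateSpecies B (z' - z)).F n := by
  have hB : (translateSpecies B z').F = (translateSpecies B (z' - z)).F ∘ configShift (-z) := by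
    funext U
    simp only [translateSpecies_F, Function.comp_apply]
    congr 1
    funext e
    simp only [configShift_apply, sub_sub]
    congr 2
    abel
  have hA : (translateSpecies A z).F = A.F ∘ configShift (-z) := rfl
  rw [hA, hB, latticeConnectedCorr_comp_configShift]

/-- In particular the autocorrelator of a translate is that of the species. -/
theorem latticeConnectedCorr_translateSpecies_self {N : ℕ} (ρ : G →* Matrix (Fin N) (Fin N) ℂ)
    (β : ℝ) (S : ℕ) [NeZero S] (A : YMSpecies G)
    (z : Literature.Probability.LatticeModels.Site 4) (n : ℕ) :
    latticeConnectedCorr ρ β S (translateSpecies A z).F (translateSpecies A z).F n =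
      latticeConnectedCorr ρ β S A.F A.F n :=
  latticeConnectedCorr_comp_configShift ρ β S A.F A.F (-z) n


/-! ### The smeared species -/

/-- **The spatially smeared species** `∑_{i ∈ s} hᵢ · O(· + zᵢ)`: a finite linear combination of
translates of ONE species `O` — the lattice form of the statement's smeared field
`a⁴ ∑ₓ f(a x) c O(τₓ U)` at fixed lattice time when the `zᵢ` are spatial (`zᵢ 0 = 0`) and
`hᵢ = c a⁴ f(a zᵢ)`. -/
def smearSpecies (O : YMSpecies G) {ι : Type*} (s : Finset ι) (h : ι → ℝ)
    (z : ι → Literature.Probability.LatticeModels.Site 4) : YMSpecies G :=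
  linCombSpecies s h fun i => translateSpecies O (z i)

omit [TopologicalSpace G] [IsTopologicalGroup G] [CompactSpace G] [BorelSpace G] in
/-- A spatial smearing of a time-zero spatial species is time-zero spatial. -/
theorem isTimeZeroSpatial_smearSpecies {O : YMSpecies G} (hO : IsTimeZeroSpatial O) {ι : Type*}
    {s : Finset ι} (h : ι → ℝ) {z : ι → Literature.Probability.LatticeModels.Site 4}
    (hz : ∀ i ∈ s, z i 0 = 0) :
    IsTimeZeroSpatial (smearSpecies O s h z) :=
  isTimeZeroSpatial_linCombSpecies fun i hi => isTimeZeroSpatial_translateSpecies hO (hz i hi)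

end Summit.QuantumFields.YangMills.Theorems.SoloBlind

end
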